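import Summits.CriticalPhenomena.PercolationContinuityZ3.Theorems.PercNearOneGluingNoHeavyLowerTailSunflowerKDecreasingPrelim
import Summits.CriticalPhenomena.PercolationContinuityZ3.Theorems.PercNearOneGluingNoHeavyLowerTailSunflowerPosynomialBound
import HarnessLib

/-!
# `NoHeavyLowerTail` (crux stmt-CriticalPhenomena-4575), abstract sunflower cubic: the K-DECREASING-FUNCTIONS LEMMA
# (analytic engine of the Δ-system-core theorem for Lemma A / (C1-law))

Support file (seat `prim-ineq-prove-1` gen 34; `--supports stmt-CriticalPhenomena-4575`).  No `sorry`, no named facts.  Memo: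
run/shared/lean/prim/prim-ineq-prove-1/FINDING-PRINCIPALCORE-prove1-g34.md §4.  Prerequisites: `…SunflowerKDecreasingPrelim` (cube,
min-functions, two-coordinate conditioning), `…SunflowerPosynomialBound` (endpoint bound for products of posynomials).

MAIN THEOREM (`prod_Ex_fmin_le`).  `p ∈ [0,1]^g` (absence probabilities), `P₁ = ∏ p`, `R ≥ 1`, min-functions `fmin R (r i)` with
`1 ≤ r i x` and `∏_{i∈s} r i x ≤ R` for every coordinate `x`:   `∏_{i∈s} Ex p (fmin R (r i)) ≤ R · (P₁R + 1 − P₁)^(|s|−1)`.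
COROLLARY (`prod_Ex_le_of_antitone`, the "K decreasing functions lemma"): the same bound for `∏_{i∈s} Ex p (F i)` whenever each `F i` is
antitone in `S`, `1 ≤ F i ≤ R`, and `∏_{i∈s} F i S ≤ R` for every nonempty `S` (as `F i ≤ fmin R (F i {·})`).
PROOF.  `prod_Ex_le_max_merge` — MERGING two active coordinates `e ≠ e'`: along the hyperbola `p e · p e' = ρ` each factor is
`c_i + a_i x + b_i ρ/x` with `a_i, b_i ≥ 0` (monotonicity of `fmin`) and `c_i > 0` (supermodularity), so by `prod_posy_le_max` the product
is bounded by its value at `(ρ,1)` or `(1,ρ)` — one active coordinate fewer, same `P₁`; induction on the number of active coordinates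
(`prod_Ex_fmin_le`); one active coordinate: `Ex = P₁R + (1−P₁)·min(r i e₀, R)` (`Ex_of_one_active`) and
`∏_i (α + βz_i) ≤ (α + β∏z_i)(α+β)^(K−1)` (`prod_affine_le`); a coordinate with `p = 0` makes the bound trivial.
USE (companion files): with `g` = first block of a Δ-system core, `R = 1/ζ'(∅)`, `F i S = ζ'(U_i[S])/ζ'(∅)` this is the induction step of
the BOX LEMMA `∏_i μ(Z(U_i)) ≤ μ(A)^(K−1)` (memo §3), whence Lemma A `∏_i μ(V_i) ≤ μ(A)^(K−1)` for every sunflower of up-sets whose core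
has Δ-system minimal elements (in particular ≤ 2 minimal elements), hence (C1-law), the `H`/`G`/`T` rows and Kahn's Conjecture 5 on the
complements there — unconditionally.
-/

namespace Summit.CriticalPhenomena.PercolationContinuityZ3.Theorems.SunflowerPartition

namespace KDecreasing

open Finset Real

variable {g : Type*} [Fintype g] [DecidableEq g]

/-! ## The merging step -/

section Merge

variable {ι : Type*} (s : Finset ι)

/-- **Merging two coordinates.**  For `e ≠ e'` with `0 < p e < 1`, `0 < p e'`, the product `∏_i Ex p (fmin R (r i))` is bounded by
its value after replacing `(p e, p e')` by `(p e · p e', 1)` or by `(1, p e · p e')` (whichever is larger). [this work] -/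
theorem prod_Ex_le_max_merge {p : g → ℝ} (hp : ∀ x, 0 ≤ p x ∧ p x ≤ 1) {e e' : g} (hne : e ≠ e') (he0 : 0 < p e)
    (he1 : p e < 1) (he'0 : 0 < p e') {R : ℝ} (hR : 1 ≤ R) (r : ι → g → ℝ) (hr : ∀ i ∈ s, ∀ x, 1 ≤ r i x) :
    ∏ i ∈ s, Ex p (fmin R (r i)) ≤
      max (∏ i ∈ s, Ex (Function.update (Function.update p e (p e * p e')) e' 1) (fmin R (r i)))
          (∏ i ∈ s, Ex (Function.update (Function.update p e 1) e' (p e * p e')) (fmin R (r i))) := by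
  set ρ := p e * p e' with hπ
  have hπ0 : 0 < ρ := mul_pos he0 he'0
  have hπ1 : ρ < 1 := by
    calc ρ = p e * p e' := rfl
      _ ≤ p e * 1 := mul_le_mul_of_nonneg_left (hp e').2 he0.le
      _ < 1 := by linarith
  have hπx : ρ ≤ p e := by
    calc ρ = p e * p e' := rfl
      _ ≤ p e * 1 := mul_le_mul_of_nonneg_left (hp e').2 he0.le
      _ = p e := mul_one _
  -- the one-parameter family along the hyperbola
  let q : ℝ → g → ℝ := fun x => Function.update (Function.update p e x) e' (ρ / x)
  have hqe : ∀ x, q x e = x := fun x => by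
    simp only [q, Function.update_of_ne hne, Function.update_self]
  have hqe' : ∀ x, q x e' = ρ / x := fun x => by simp only [q, Function.update_self]
  have hq0 : q (p e) = p := by
    funext z
    by_cases hz' : z = e'
    · subst hz'; rw [hqe']; rw [hπ]; field_simp
    · by_cases hz : z = e
      · subst hz; exact hqe _
      · simp only [q, Function.update_of_ne hz', Function.update_of_ne hz]
  have hqπ : q ρ = Function.update (Function.update p e (p e * p e')) e' 1 := by
    show Function.update (Function.update p e ρ) e' (ρ / ρ) = _
    rw [div_self hπ0.ne']
  have hq1 : q 1 = Function.update (Function.update p e 1) e' (p e * p e') := by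
    show Function.update (Function.update p e 1) e' (ρ / 1) = _
    rw [div_one]
  -- coefficients
  let A : ι → Bool → Bool → ℝ := fun i se se' => condSum p e e' (fmin R (r i)) se se'
  let c : ι → ℝ := fun i => ρ * (A i false false - A i false true - A i true false + A i true true) + A i true true
  let a : ι → ℝ := fun i => A i false true - A i true true
  let b : ι → ℝ := fun i => A i true false - A i true true
  have hΓ : ∀ x, 0 < x → ∀ i ∈ s, Ex (q x) (fmin R (r i)) = c i + a i * x + b i * (ρ / x) := by
    intro x hx i _
    rw [Ex_expand hne, hqe, hqe']
    simp only [q, condSum_update, c, a, b, A]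
    field_simp
    ring
  have hF1 : ∀ i ∈ s, ∀ S, 1 ≤ fmin R (r i) S := fun i hi S => one_le_fmin hR (hr i hi) S
  have ha : ∀ i ∈ s, 0 ≤ a i := fun i hi =>
    sub_nonneg.2 (condSum_anti (e := e) (e' := e') hp (fun x T => fmin_insert_le R (r i) x T) true).2
  have hb : ∀ i ∈ s, 0 ≤ b i := fun i hi =>
    sub_nonneg.2 (condSum_anti (e := e) (e' := e') hp (fun x T => fmin_insert_le R (r i) x T) true).1
  have hc : ∀ i ∈ s, 0 < c i := by
    intro i hi
    have hsm := condSum_supermod (e := e) (e' := e') hp (fun x y T => fmin_supermodular R (r i) x y T)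
    have h11 := one_le_condSum (e := e) (e' := e') hp (hF1 i hi) true true
    show 0 < ρ * (A i false false - A i false true - A i true false + A i true true) + A i true true
    have : 0 ≤ A i false false - A i false true - A i true false + A i true true := by
      show 0 ≤ condSum p e e' _ false false - condSum p e e' _ false true - condSum p e e' _ true false +
        condSum p e e' _ true true
      linarith
    have : (1 : ℝ) ≤ A i true true := h11
    positivity
  -- assemble
  have lhs : ∏ i ∈ s, Ex p (fmin R (r i)) = ∏ i ∈ s, (c i + a i * p e + b i * (ρ / p e)) := by
    conv_lhs => rw [← hq0]
    exact Finset.prod_congr rfl (hΓ (p e) he0)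
  have r1 : ∏ i ∈ s, Ex (q ρ) (fmin R (r i)) = ∏ i ∈ s, (c i + a i * ρ + b i) := by
    refine Finset.prod_congr rfl fun i hi => ?_
    rw [hΓ ρ hπ0 i hi, div_self hπ0.ne', mul_one]
  have r2 : ∏ i ∈ s, Ex (q 1) (fmin R (r i)) = ∏ i ∈ s, (c i + a i + b i * ρ) := by
    refine Finset.prod_congr rfl fun i hi => ?_
    rw [hΓ 1 one_pos i hi, mul_one, div_one]
  rw [lhs, ← hqπ, ← hq1, r1, r2]
  exact prod_posy_le_max s c a b hc ha hb hπ0 hπ1 hπx (hp e).2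

end Merge


/-! ## One active coordinate, and the main theorem by induction on the number of active coordinates -/

section Main

variable {ι : Type*} (s : Finset ι)

/-- Two-point merging of the affine factors: `(α + βu)(α + βv) ≤ (α + βuv)(α + β)` for `u, v ≥ 1`. [this work] -/
theorem affine_mul_affine_le {α β u v : ℝ} (hα : 0 ≤ α) (hβ : 0 ≤ β) (hu : 1 ≤ u) (hv : 1 ≤ v) :
    (α + β * u) * (α + β * v) ≤ (α + β * (u * v)) * (α + β) := by
  nlinarith [mul_nonneg (mul_nonneg hα hβ) (mul_nonneg (sub_nonneg.2 hu) (sub_nonneg.2 hv))]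

/-- `∏_i (α + β z_i) ≤ (α + β ∏_i z_i)(α + β)^{|s|−1}` for `z_i ≥ 1` and nonempty `s`. [this work] -/
theorem prod_affine_le {α β : ℝ} (hα : 0 ≤ α) (hβ : 0 ≤ β) (z : ι → ℝ) (hz : ∀ i ∈ s, 1 ≤ z i) (hs : s.Nonempty) :
    ∏ i ∈ s, (α + β * z i) ≤ (α + β * ∏ i ∈ s, z i) * (α + β) ^ (s.card - 1) := by
  classical
  induction s using Finset.induction_on with
  | empty => exact absurd hs Finset.not_nonempty_empty
  | @insert j t hj ih =>
    rw [Finset.prod_insert hj, Finset.prod_insert hj, Finset.card_insert_of_notMem hj]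
    by_cases ht : t.Nonempty
    · have hz' : ∀ i ∈ t, 1 ≤ z i := fun i hi => hz i (Finset.mem_insert_of_mem hi)
      have hzt : 1 ≤ ∏ i ∈ t, z i := by
        calc (1 : ℝ) = ∏ i ∈ t, (1 : ℝ) := by simp
          _ ≤ ∏ i ∈ t, z i := Finset.prod_le_prod (fun i _ => zero_le_one) hz'
      have ih' := ih hz' ht
      have hzj : 1 ≤ z j := hz j (Finset.mem_insert_self j t)
      have hcard : t.card - 1 + 1 = t.card := Nat.sub_add_cancel (Finset.card_pos.2 ht)
      calc (α + β * z j) * ∏ i ∈ t, (α + β * z i)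
          ≤ (α + β * z j) * ((α + β * ∏ i ∈ t, z i) * (α + β) ^ (t.card - 1)) :=
            mul_le_mul_of_nonneg_left ih' (by positivity)
        _ = ((α + β * z j) * (α + β * ∏ i ∈ t, z i)) * (α + β) ^ (t.card - 1) := by ring
        _ ≤ ((α + β * (z j * ∏ i ∈ t, z i)) * (α + β)) * (α + β) ^ (t.card - 1) :=
            mul_le_mul_of_nonneg_right (affine_mul_affine_le hα hβ hzj hzt) (by positivity)
        _ = (α + β * (z j * ∏ i ∈ t, z i)) * ((α + β) ^ (t.card - 1) * (α + β)) := by ring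
        _ = (α + β * (z j * ∏ i ∈ t, z i)) * (α + β) ^ (t.card + 1 - 1) := by
            rw [← pow_succ, hcard, Nat.add_sub_cancel]
    · rw [Finset.not_nonempty_iff_eq_empty.1 ht]
      simp

variable {p : g → ℝ}

/-- With no active coordinate (`p ≡ 1`), `S = ∅` surely and `Ex p F = F ∅`. [this work] -/
theorem Ex_of_all_one (h1 : ∀ x, p x = 1) (F : Finset g → ℝ) : Ex p F = F ∅ := by
  unfold Ex
  rw [Finset.sum_eq_single ∅]
  · have : wt p ∅ = 1 := by
      unfold wt; exact Finset.prod_eq_one fun x _ => by simp [h1 x]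
    rw [this, one_mul]
  · intro S _ hS
    obtain ⟨x, hx⟩ := Finset.nonempty_iff_ne_empty.2 hS
    rw [wt_eq_zero_of_mem (h1 x) hx, zero_mul]
  · intro h; exact absurd (Finset.mem_univ _) h

/-- With exactly one active coordinate `e₀` (`p x = 1` for `x ≠ e₀`): `Ex p F = p e₀ · F ∅ + (1 − p e₀) · F {e₀}`. [this work] -/
theorem Ex_of_one_active {e₀ : g} (h1 : ∀ x, x ≠ e₀ → p x = 1) (F : Finset g → ℝ) :
    Ex p F = p e₀ * F ∅ + (1 - p e₀) * F {e₀} := by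
  unfold Ex
  have hne : (∅ : Finset g) ≠ {e₀} := (Finset.singleton_ne_empty e₀).symm
  rw [← Finset.sum_subset (Finset.subset_univ ({∅, {e₀}} : Finset (Finset g))), Finset.sum_pair hne]
  · have hrest : ∏ x ∈ Finset.univ.erase e₀, (if x ∈ (∅ : Finset g) then 1 - p x else p x) = 1 :=
      Finset.prod_eq_one fun x hx => by
        rw [Finset.mem_erase] at hx
        simp [h1 x hx.1]
    have hrest' : ∏ x ∈ Finset.univ.erase e₀, (if x ∈ ({e₀} : Finset g) then 1 - p x else p x) = 1 :=
      Finset.prod_eq_one fun x hx => by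
        rw [Finset.mem_erase] at hx
        simp [h1 x hx.1, hx.1]
    have w0 : wt p ∅ = p e₀ := by
      unfold wt
      rw [← Finset.mul_prod_erase Finset.univ _ (Finset.mem_univ e₀), hrest]
      simp
    have w1 : wt p {e₀} = 1 - p e₀ := by
      unfold wt
      rw [← Finset.mul_prod_erase Finset.univ _ (Finset.mem_univ e₀), hrest']
      simp
    rw [w0, w1]
  · intro S _ hS
    -- `S ∉ {∅, {e₀}}`: it contains some `x ≠ e₀`
    have : ∃ x ∈ S, x ≠ e₀ := by
      by_contra hcon
      push Not at hcon
      have hsub : S ⊆ {e₀} := fun x hx => Finset.mem_singleton.2 (hcon x hx)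
      rcases Finset.subset_singleton_iff.1 hsub with h | h
      · exact hS (by simp [h])
      · exact hS (by simp [h])
    obtain ⟨x, hxS, hx⟩ := this
    rw [wt_eq_zero_of_mem (h1 x hx) hxS, zero_mul]

/-- The product of all `p` splits off two coordinates. [this work] -/
theorem prod_eq_mul_mul_prod_rest {e e' : g} (hne : e ≠ e') (q : g → ℝ) :
    ∏ x, q x = q e * (q e' * ∏ x ∈ (Finset.univ.erase e).erase e', q x) := by
  rw [← Finset.mul_prod_erase Finset.univ _ (Finset.mem_univ e),
    ← Finset.mul_prod_erase (Finset.univ.erase e) _ (Finset.mem_erase.2 ⟨Ne.symm hne, Finset.mem_univ e'⟩)]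

/-- Merging preserves `P₁ = ∏ p`. [this work] -/
theorem prod_update_update {e e' : g} (hne : e ≠ e') (u v : ℝ) :
    ∏ x, Function.update (Function.update p e u) e' v x = u * v * ∏ x ∈ (Finset.univ.erase e).erase e', p x := by
  rw [prod_eq_mul_mul_prod_rest hne, Function.update_self, Function.update_of_ne hne, Function.update_self, ← mul_assoc]
  congr 1
  refine Finset.prod_congr rfl fun x hx => ?_
  rw [Finset.mem_erase, Finset.mem_erase] at hx
  rw [Function.update_of_ne hx.1, Function.update_of_ne hx.2.1]

/-- **MAIN THEOREM** (memo §4, "CLAIM''" in multiplicative form).  For `p ∈ [0,1]^g` (absence probabilities), `R ≥ 1`, and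
min-functions `fmin R (r i)` with `1 ≤ r i x` and `∏_i r i x ≤ R` for every coordinate `x`:
`∏_{i∈s} Ex p (fmin R (r i)) ≤ R · (P₁ R + 1 − P₁)^(|s|−1)`, `P₁ = ∏_x p x`. [this work] -/
theorem prod_Ex_fmin_le (hp : ∀ x, 0 ≤ p x ∧ p x ≤ 1) {R : ℝ} (hR : 1 ≤ R) (r : ι → g → ℝ)
    (hr1 : ∀ i ∈ s, ∀ x, 1 ≤ r i x) (hrR : ∀ x, ∏ i ∈ s, r i x ≤ R) :
    ∏ i ∈ s, Ex p (fmin R (r i)) ≤ R * ((∏ x, p x) * R + 1 - ∏ x, p x) ^ (s.card - 1) := by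
  -- induction on the number of active coordinates
  suffices H : ∀ (n : ℕ) (q : g → ℝ), (∀ x, 0 ≤ q x ∧ q x ≤ 1) → (Finset.univ.filter fun x => q x < 1).card ≤ n →
      ∏ i ∈ s, Ex q (fmin R (r i)) ≤ R * ((∏ x, q x) * R + 1 - ∏ x, q x) ^ (s.card - 1) from
    H _ p hp le_rfl
  intro n
  induction n with
  | zero =>
    intro q hq hcard
    -- no active coordinate
    have h1 : ∀ x, q x = 1 := fun x => by
      by_contra hx
      have hlt : q x < 1 := lt_of_le_of_ne (hq x).2 hx
      have : x ∈ Finset.univ.filter fun x => q x < 1 := Finset.mem_filter.2 ⟨Finset.mem_univ x, hlt⟩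
      rw [Nat.le_zero, Finset.card_eq_zero] at hcard
      rw [hcard] at this
      exact absurd this (Finset.notMem_empty x)
    have hP : ∏ x, q x = 1 := Finset.prod_eq_one fun x _ => h1 x
    rw [hP]
    simp only [Ex_of_all_one h1, fmin_empty, one_mul, add_sub_cancel_right, Finset.prod_const]
    rcases Nat.eq_zero_or_pos s.card with h0 | hpos
    · rw [h0]; simpa using hR
    · rw [← pow_succ', Nat.sub_add_cancel hpos]
  | succ n ih =>
    intro q hq hcard
    -- a zero probability makes the bound trivial
    by_cases hz : ∃ x, q x = 0
    · obtain ⟨x₀, hx₀⟩ := hz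
      have hP : ∏ x, q x = 0 := Finset.prod_eq_zero (Finset.mem_univ x₀) hx₀
      rw [hP, zero_mul, zero_add, sub_zero, one_pow, mul_one]
      calc ∏ i ∈ s, Ex q (fmin R (r i)) ≤ ∏ i ∈ s, r i x₀ := by
            refine Finset.prod_le_prod (fun i hi => Ex_nonneg hq fun S => ?_) fun i hi => ?_
            · exact zero_le_one.trans (one_le_fmin hR (hr1 i hi) S)
            · refine Ex_le_const hq fun S hS => fmin_le_of_mem R (r i) ?_
              by_contra hx
              exact hS (wt_eq_zero_of_notMem hx₀ hx)
        _ ≤ R := hrR x₀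
    push Not at hz
    have hqpos : ∀ x, 0 < q x := fun x => lt_of_le_of_ne (hq x).1 (Ne.symm (hz x))
    set act := Finset.univ.filter fun x => q x < 1 with hact
    rcases Nat.lt_or_ge act.card 2 with hsmall | hbig
    · -- at most one active coordinate
      rcases Nat.lt_or_ge act.card 1 with h0 | h1'
      · exact ih q hq (by change act.card ≤ n; omega)
      · -- exactly one active coordinate `e₀`
        have hc1 : act.card = 1 := by omega
        obtain ⟨e₀, he₀⟩ := Finset.card_eq_one.1 hc1
        have hothers : ∀ x, x ≠ e₀ → q x = 1 := fun x hx => by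
          by_contra h
          have : x ∈ act := Finset.mem_filter.2 ⟨Finset.mem_univ x, lt_of_le_of_ne (hq x).2 h⟩
          rw [he₀, Finset.mem_singleton] at this
          exact hx this
        have hP : ∏ x, q x = q e₀ := by
          rw [← Finset.mul_prod_erase Finset.univ _ (Finset.mem_univ e₀)]
          rw [Finset.prod_eq_one fun x hx => hothers x (Finset.mem_erase.1 hx).1, mul_one]
        rw [hP]
        rcases s.eq_empty_or_nonempty with hs | hs
        · rw [hs]; simpa using hR
        have hEx : ∀ i ∈ s, Ex q (fmin R (r i)) ≤ q e₀ * R + (1 - q e₀) * r i e₀ := by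
          intro i hi
          rw [Ex_of_one_active hothers, fmin_empty, fmin_singleton]
          have : min (r i e₀) R ≤ r i e₀ := min_le_left _ _
          nlinarith [(hq e₀).2]
        calc ∏ i ∈ s, Ex q (fmin R (r i)) ≤ ∏ i ∈ s, (q e₀ * R + (1 - q e₀) * r i e₀) :=
              Finset.prod_le_prod (fun i hi => Ex_nonneg hq fun S => zero_le_one.trans (one_le_fmin hR (hr1 i hi) S)) hEx
          _ ≤ (q e₀ * R + (1 - q e₀) * ∏ i ∈ s, r i e₀) * (q e₀ * R + (1 - q e₀)) ^ (s.card - 1) :=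
              prod_affine_le s (by nlinarith [(hq e₀).1]) (by linarith [(hq e₀).2]) _ (fun i hi => hr1 i hi e₀) hs
          _ ≤ (q e₀ * R + (1 - q e₀) * R) * (q e₀ * R + (1 - q e₀)) ^ (s.card - 1) := by
              have h2 : 0 ≤ (q e₀ * R + (1 - q e₀)) ^ (s.card - 1) := by
                apply pow_nonneg; nlinarith [(hq e₀).1, (hq e₀).2]
              exact mul_le_mul_of_nonneg_right (by nlinarith [(hq e₀).2, hrR e₀]) h2
          _ = R * (q e₀ * R + 1 - q e₀) ^ (s.card - 1) := by ring
    · -- two active coordinates: merge them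
      obtain ⟨e, he, e', he', hne⟩ := Finset.one_lt_card.1 (by omega : 1 < act.card)
      have hqe : q e < 1 := (Finset.mem_filter.1 he).2
      have hqe' : q e' < 1 := (Finset.mem_filter.1 he').2
      have hmerge := prod_Ex_le_max_merge s hq hne (hqpos e) hqe (hqpos e') hR r hr1
      -- both merged configurations have fewer active coordinates and the same `∏`
      have hrest : ∏ x, q x = q e * q e' * ∏ x ∈ (Finset.univ.erase e).erase e', q x := by
        rw [prod_eq_mul_mul_prod_rest hne, mul_assoc]
      have hq' : ∀ (u v : ℝ), 0 ≤ u → u ≤ 1 → 0 ≤ v → v ≤ 1 →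
          ∀ x, 0 ≤ Function.update (Function.update q e u) e' v x ∧ Function.update (Function.update q e u) e' v x ≤ 1 := by
        intro u v hu0 hu1 hv0 hv1 x
        by_cases hx' : x = e'
        · subst hx'; simp [hv0, hv1]
        · by_cases hx : x = e
          · subst hx; simp [Function.update_of_ne hx', hu0, hu1]
          · simp [Function.update_of_ne hx', Function.update_of_ne hx, hq x]
      have huv0 : 0 ≤ q e * q e' := mul_nonneg (hq e).1 (hq e').1
      have huv1 : q e * q e' ≤ 1 := by nlinarith [(hq e).1, (hq e).2, (hq e').1, (hq e').2]
      have hcard' : ∀ (u v : ℝ) (y : g), y ∈ act → Function.update (Function.update q e u) e' v y = 1 →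
          (Finset.univ.filter fun x => Function.update (Function.update q e u) e' v x < 1).card ≤ n := by
        intro u v y hy hy1
        have hsub : (Finset.univ.filter fun x => Function.update (Function.update q e u) e' v x < 1) ⊆ act.erase y := by
          intro x hx
          rw [Finset.mem_filter] at hx
          rw [Finset.mem_erase]
          refine ⟨fun h => ?_, ?_⟩
          · rw [h, hy1] at hx; exact lt_irrefl _ hx.2
          · rw [Finset.mem_filter]
            refine ⟨Finset.mem_univ x, ?_⟩
            by_cases hx' : x = e'
            · subst hx'; exact hqe'
            · by_cases hxe : x = e
              · subst hxe; exact hqe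
              · have := hx.2; rwa [Function.update_of_ne hx', Function.update_of_ne hxe] at this
        have := Finset.card_le_card hsub
        rw [Finset.card_erase_of_mem hy] at this
        omega
      refine hmerge.trans (max_le ?_ ?_)
      · have h := ih _ (hq' _ _ huv0 huv1 zero_le_one le_rfl) (hcard' _ _ e' he' (by simp))
        rwa [prod_update_update hne, mul_one, ← hrest] at h
      · have h := ih _ (hq' _ _ zero_le_one le_rfl huv0 huv1)
          (hcard' _ _ e he (by simp [Function.update_of_ne hne]))
        rwa [prod_update_update hne, one_mul, ← hrest] at h

/-- **COROLLARY: the K-decreasing-functions lemma** (memo §4).  If each `F i` is antitone in `S`, `1 ≤ F i ≤ R`, and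
`∏_i F i S ≤ R` for every nonempty `S`, then `∏_{i∈s} Ex p (F i) ≤ R · (P₁R + 1 − P₁)^(|s|−1)`. [this work] -/
theorem prod_Ex_le_of_antitone (hp : ∀ x, 0 ≤ p x ∧ p x ≤ 1) {R : ℝ} (hR : 1 ≤ R) (F : ι → Finset g → ℝ)
    (hanti : ∀ i ∈ s, ∀ S T : Finset g, S ⊆ T → F i T ≤ F i S) (h1 : ∀ i ∈ s, ∀ S, 1 ≤ F i S)
    (hFR : ∀ i ∈ s, ∀ S, F i S ≤ R) (hprod : ∀ S : Finset g, S.Nonempty → ∏ i ∈ s, F i S ≤ R) :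
    ∏ i ∈ s, Ex p (F i) ≤ R * ((∏ x, p x) * R + 1 - ∏ x, p x) ^ (s.card - 1) := by
  let r : ι → g → ℝ := fun i x => F i {x}
  calc ∏ i ∈ s, Ex p (F i) ≤ ∏ i ∈ s, Ex p (fmin R (r i)) :=
        Finset.prod_le_prod (fun i hi => Ex_nonneg hp fun S => zero_le_one.trans (h1 i hi S))
          fun i hi => Ex_mono hp fun S => le_fmin_of_antitone (hanti i hi) (hFR i hi) S
    _ ≤ R * ((∏ x, p x) * R + 1 - ∏ x, p x) ^ (s.card - 1) :=
        prod_Ex_fmin_le s hp hR r (fun i hi x => h1 i hi {x}) fun x => hprod {x} (Finset.singleton_nonempty x)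

/-- **Unnormalised form** (the shape used by the box lemma): if each `G i` is antitone, `c ≤ G i S ≤ 1` with `0 < c`, `G i ∅ = 1`... (only
`G i ≤ 1` is needed), and `∏_{i∈s} G i S ≤ c^(|s|−1)` for every nonempty `S`, then `∏_{i∈s} Ex p (G i) ≤ (P₁ + (1 − P₁)c)^(|s|−1)`. [this work] -/
theorem prod_Ex_le_of_antitone' (hp : ∀ x, 0 ≤ p x ∧ p x ≤ 1) {c : ℝ} (hc : 0 < c) (hc1 : c ≤ 1) (G : ι → Finset g → ℝ)
    (hanti : ∀ i ∈ s, ∀ S T : Finset g, S ⊆ T → G i T ≤ G i S) (hcG : ∀ i ∈ s, ∀ S, c ≤ G i S)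
    (hG1 : ∀ i ∈ s, ∀ S, G i S ≤ 1) (hprod : ∀ S : Finset g, S.Nonempty → ∏ i ∈ s, G i S ≤ c ^ (s.card - 1)) :
    ∏ i ∈ s, Ex p (G i) ≤ ((∏ x, p x) + (1 - ∏ x, p x) * c) ^ (s.card - 1) := by
  rcases s.eq_empty_or_nonempty with hs | hs
  · rw [hs]; simp
  set P₁ := ∏ x, p x with hP₁
  have hK : 1 ≤ s.card := Finset.card_pos.2 hs
  let F : ι → Finset g → ℝ := fun i S => G i S / c
  have hF : ∏ i ∈ s, Ex p (F i) ≤ (1 / c) * (P₁ * (1 / c) + 1 - P₁) ^ (s.card - 1) := by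
    refine prod_Ex_le_of_antitone s hp (by rw [le_div_iff₀ hc, one_mul]; exact hc1) F ?_ ?_ ?_ ?_
    · intro i hi S T hST; exact div_le_div_of_nonneg_right (hanti i hi S T hST) hc.le
    · intro i hi S; rw [le_div_iff₀ hc, one_mul]; exact hcG i hi S
    · intro i hi S; exact div_le_div_of_nonneg_right (hG1 i hi S) hc.le
    · intro S hS
      have : ∏ i ∈ s, F i S = (∏ i ∈ s, G i S) / c ^ s.card := by
        simp only [F, Finset.prod_div_distrib, Finset.prod_const]
      rw [this, div_le_iff₀ (pow_pos hc _)]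
      calc ∏ i ∈ s, G i S ≤ c ^ (s.card - 1) := hprod S hS
        _ = 1 / c * c ^ s.card := by
            rw [← Nat.sub_add_cancel hK, pow_succ, Nat.add_sub_cancel]; field_simp
  have hEx : ∀ i ∈ s, Ex p (F i) = Ex p (G i) / c := by
    intro i _
    simp only [Ex, F, mul_div_assoc', Finset.sum_div]
  rw [Finset.prod_congr rfl hEx, Finset.prod_div_distrib, Finset.prod_const, div_le_iff₀ (pow_pos hc _)] at hF
  calc ∏ i ∈ s, Ex p (G i) ≤ 1 / c * (P₁ * (1 / c) + 1 - P₁) ^ (s.card - 1) * c ^ s.card := hF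
    _ = (P₁ + (1 - P₁) * c) ^ (s.card - 1) := by
        rw [← Nat.sub_add_cancel hK, pow_succ, Nat.add_sub_cancel]
        rw [show P₁ * (1 / c) + 1 - P₁ = (P₁ + (1 - P₁) * c) / c from by field_simp; ring]
        rw [div_pow]
        field_simp

end Main

end KDecreasing

end Summit.CriticalPhenomena.PercolationContinuityZ3.Theorems.SunflowerPartition
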